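import Mathlib
import Summits.NavierStokesRegularity.NavierStokesRegularity.Theorems.FilamentSkeletonRssMatchedKernelVariationPoint
import Summits.NavierStokesRegularity.NavierStokesRegularity.Theorems.FilamentSkeletonRssMatchedKernelTangencyProjection

/-!
# THE LINEARISED NORMAL-VELOCITY MAP of clause 13-J in CLOSED FORM:
# `d/ds T(X + sY) j τ |₀` for the crux's matched-kernel tangency defect `T` (route `FilamentSkeletonRss`, child 28296
# `Clause13NearStraight` of `SkeletonJ1G`, stmt-27849)

In `SkeletonJ1G` / `Clause13NearStraight` the objects are let-bound by their defining equations
`u Z y = Σ_k (Γγ_k/4π) • ∫ ((‖y − Z k σ‖² + κ·Aa k σ)^{3/2})⁻¹ • (Z_k′σ × (y − Z k σ)) dσ` (`κ = e^{−(1+γ_E−log 2)}`) and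
`T Z j τ = W − (⟪W, Z_j′τ⟫/‖Z_j′τ‖²)•Z_j′τ`, `W = u Z (Z j τ) + ½ Z j τ − α e₃ × Z j τ`, and clause 13-J measures a variation `Y` by
`deriv (fun s => T (fun k σ => X k σ + s•Y k σ) j τ) 0`.  This file turns that opaque `deriv` into an explicit integral operator:
under `C¹` regularity of `X k`, `Y k` (`‖X_k′‖ ≤ 1`, linear growth `c|σ| − C ≤ ‖X k σ‖`, `‖Y k‖, ‖Y_k′‖ ≤ B`), continuity of the
core areas with a floor `0 < A₀ ≤ Aa k σ`, the function `s ↦ T(X + sY) j τ` HAS A DERIVATIVE at `0`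
(`linearisedMap_hasDerivAt`; general tangent `X_j′τ ≠ 0`), and at a point of exact tangency with unit tangent
(`u X (X j τ) + ½X j τ − α e₃×X j τ = w•X_j′τ`, `‖X_j′τ‖ = 1` — the crux's in-ball clause) the derivative is
`W′ − ⟪W′, X_j′τ⟫•X_j′τ + (w⟪X_j′τ, Y_j′τ⟫)•X_j′τ − w•Y_j′τ` with
`W′ = Σ_k (Γγ_k/4π) • ∫ D_k σ dσ + ½•Y j τ − α•e₃ × Y j τ`,
`D_k σ = (−3⟪X j τ − X k σ, Y j τ − Y k σ⟫ K₅) • X_k′σ × (X j τ − X k σ) + K₃ • (X_k′σ × (Y j τ − Y k σ) + Y_k′σ × (X j τ − X k σ))`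
(`linearisedMap_hasDerivAt_tangent`, `deriv_linearisedMap_tangent`).  Ingredients: `matchedBiotSavart_hasDerivAt_movingPoint`
(p658174), `hasDerivAt_tangencyDefect(_unit)` (…TangencyProjection), `HasDerivAt.sum`, and the bilinear `crossCLM`.
Lane ns-filament-19175-p1 g12 (hand of record for 28296); `--supports stmt-NavierStokesRegularity-28296 --as helper`.
HONEST FRAMING: calculus for a HYPOTHETICAL filament skeleton on the NEGATIVE side of a MODEL route; nothing here bears on
Navier–Stokes regularity or blow-up.
-/

noncomputable section

open scoped InnerProductSpace BigOperators
open MeasureTheory Filter Topology Metric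
open Literature.Analysis.FluidPDE

namespace Summit.NavierStokesRegularity.NavierStokesRegularity.Theorems.MatchedKernel
set_option linter.dupNamespace false

/-- The derivative of the displaced filament `σ ↦ X σ + s•Y σ` is `X′σ + s•Y′σ`. [folklore] -/
theorem deriv_add_smul_curve {X Y : ℝ → EuclideanSpace ℝ (Fin 3)} (hX : ContDiff ℝ 1 X) (hY : ContDiff ℝ 1 Y) (s σ : ℝ) :
    deriv (fun σ => X σ + s • Y σ) σ = deriv X σ + s • deriv Y σ := by
  have h1 : DifferentiableAt ℝ X σ := (hX.differentiable (by norm_num)).differentiableAt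
  have h2 : DifferentiableAt ℝ Y σ := (hY.differentiable (by norm_num)).differentiableAt
  exact (h1.hasDerivAt.add (h2.hasDerivAt.const_smul s)).deriv

/-- **`W′`: the derivative of the velocity part** `s ↦ u (X+sY) ((X+sY) j τ) + ½ (X+sY) j τ − α e₃ × (X+sY) j τ` at `s = 0`,
for the matched-kernel field `u` given by its defining equation `hu` (as let-bound in the crux). [folklore] -/
theorem velocityPart_hasDerivAt {N : ℕ} {Γ α c C B A₀ : ℝ} {γ : Fin N → ℝ}
    {X Y : Fin N → ℝ → EuclideanSpace ℝ (Fin 3)} {Aa : Fin N → ℝ → ℝ}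
    {u : (Fin N → ℝ → EuclideanSpace ℝ (Fin 3)) → EuclideanSpace ℝ (Fin 3) → EuclideanSpace ℝ (Fin 3)}
    (hu : ∀ Z y, u Z y = ∑ k, (Γ * γ k / (4 * Real.pi)) • ∫ σ : ℝ,
      ((‖y - Z k σ‖ ^ 2 + Real.exp (-(1 + Real.eulerMascheroniConstant - Real.log 2)) * Aa k σ) ^ (3 / 2 : ℝ))⁻¹ •
        cross (deriv (Z k) σ) (y - Z k σ))
    (hc : 0 < c) (hX : ∀ k, ContDiff ℝ 1 (X k)) (hX1 : ∀ k σ, ‖deriv (X k) σ‖ ≤ 1) (hXg : ∀ k σ, c * |σ| - C ≤ ‖X k σ‖)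
    (hA : ∀ k, Continuous (Aa k)) (hA₀ : 0 < A₀) (hA0 : ∀ k σ, A₀ ≤ Aa k σ)
    (hY : ∀ k, ContDiff ℝ 1 (Y k)) (hB : 0 ≤ B) (hYb : ∀ k σ, ‖Y k σ‖ ≤ B) (hY'b : ∀ k σ, ‖deriv (Y k) σ‖ ≤ B)
    (j : Fin N) (τ : ℝ) :
    HasDerivAt (fun s : ℝ =>
        u (fun k σ => X k σ + s • Y k σ) (X j τ + s • Y j τ) + (1 / 2 : ℝ) • (X j τ + s • Y j τ)
          - α • cross (EuclideanSpace.single 2 1) (X j τ + s • Y j τ))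
      ((∑ k, (Γ * γ k / (4 * Real.pi)) • ∫ σ : ℝ,
          ((-3 * ⟪X j τ - X k σ, Y j τ - Y k σ⟫_ℝ *
              ((‖X j τ - X k σ‖ ^ 2 + Real.exp (-(1 + Real.eulerMascheroniConstant - Real.log 2)) * Aa k σ) ^ (5 / 2 : ℝ))⁻¹) •
            cross (deriv (X k) σ) (X j τ - X k σ) +
          ((‖X j τ - X k σ‖ ^ 2 + Real.exp (-(1 + Real.eulerMascheroniConstant - Real.log 2)) * Aa k σ) ^ (3 / 2 : ℝ))⁻¹ •
            (cross (deriv (X k) σ) (Y j τ - Y k σ) + cross (deriv (Y k) σ) (X j τ - X k σ))))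
        + (1 / 2 : ℝ) • Y j τ - α • cross (EuclideanSpace.single 2 1) (Y j τ)) 0 := by
  set κ : ℝ := Real.exp (-(1 + Real.eulerMascheroniConstant - Real.log 2)) with hκ
  have hκ0 : 0 < κ := Real.exp_pos _
  -- each filament's term: the moving-point variation derivative
  have hterm : ∀ k : Fin N, HasDerivAt (fun s : ℝ => ∫ σ : ℝ,
        ((‖(X j τ + s • Y j τ) - (X k σ + s • Y k σ)‖ ^ 2 + κ * Aa k σ) ^ (3 / 2 : ℝ))⁻¹ •
          cross (deriv (fun σ => X k σ + s • Y k σ) σ) ((X j τ + s • Y j τ) - (X k σ + s • Y k σ)))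
      (∫ σ : ℝ, ((-3 * ⟪X j τ - X k σ, Y j τ - Y k σ⟫_ℝ * ((‖X j τ - X k σ‖ ^ 2 + κ * Aa k σ) ^ (5 / 2 : ℝ))⁻¹) •
            cross (deriv (X k) σ) (X j τ - X k σ) +
          ((‖X j τ - X k σ‖ ^ 2 + κ * Aa k σ) ^ (3 / 2 : ℝ))⁻¹ •
            (cross (deriv (X k) σ) (Y j τ - Y k σ) + cross (deriv (Y k) σ) (X j τ - X k σ)))) 0 := by
    intro k
    have hm : ∀ σ, κ * A₀ ≤ κ * Aa k σ := fun σ => mul_le_mul_of_nonneg_left (hA0 k σ) hκ0.le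
    have key := matchedBiotSavart_hasDerivAt_movingPoint (m := fun σ => κ * Aa k σ) (mul_pos hκ0 hA₀) hm
      (continuous_const.mul (hA k)) hc (hX k) (hX1 k) (hXg k) (hY k) hB (hYb k) (hY'b k) (X j τ) (Y j τ) (hYb j τ)
    refine key.congr_of_eventuallyEq (Eventually.of_forall fun s => ?_)
    refine integral_congr_ae (Eventually.of_forall fun σ => ?_)
    simp only []
    rw [deriv_add_smul_curve (hX k) (hY k) s σ]
    have : X j τ + s • Y j τ - (X k σ + s • Y k σ) = X j τ + s • (Y j τ - Y k σ) - X k σ := by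
      rw [smul_sub]; abel
    rw [this]
  -- the sum and the linear terms
  have hsum := HasDerivAt.sum (u := Finset.univ) fun k _ => (hterm k).const_smul (Γ * γ k / (4 * Real.pi))
  have h0 : HasDerivAt (fun s : ℝ => X j τ + s • Y j τ) (Y j τ) 0 := by
    simpa using ((hasDerivAt_id' (x := (0:ℝ))).smul_const (Y j τ)).const_add (X j τ)
  have hlin1 : HasDerivAt (fun s : ℝ => (1 / 2 : ℝ) • (X j τ + s • Y j τ)) ((1 / 2 : ℝ) • Y j τ) 0 :=
    h0.const_smul (1 / 2 : ℝ)
  have hcross : HasDerivAt (fun s : ℝ => cross (EuclideanSpace.single 2 1) (X j τ + s • Y j τ))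
      (cross (EuclideanSpace.single 2 1) (Y j τ)) 0 :=
    (crossCLM (EuclideanSpace.single 2 1)).hasFDerivAt.comp_hasDerivAt (0:ℝ) h0
  have hlin2 : HasDerivAt (fun s : ℝ => α • cross (EuclideanSpace.single 2 1) (X j τ + s • Y j τ))
      (α • cross (EuclideanSpace.single 2 1) (Y j τ)) 0 := hcross.const_smul α
  have hall := (hsum.add hlin1).sub hlin2
  refine hall.congr_of_eventuallyEq (Eventually.of_forall fun s => ?_)
  simp only [Pi.add_apply, Pi.sub_apply, Pi.smul_apply, Finset.sum_apply, hu]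


/-- **THE LINEARISED NORMAL-VELOCITY MAP AT A POINT OF EXACT TANGENCY** (the crux's `T`, given by its defining equation `hT`
over the field `u` given by `hu`): if `‖X_j′τ‖ = 1` and `u X (X j τ) + ½X j τ − α e₃×X j τ = w•X_j′τ` (the in-ball clause), then
`s ↦ T (X + sY) j τ` has at `s = 0` the derivative `W′ − ⟪W′, X_j′τ⟫•X_j′τ + (w⟪X_j′τ, Y_j′τ⟫)•X_j′τ − w•Y_j′τ`, `W′` as in
`velocityPart_hasDerivAt`. [folklore] -/
theorem linearisedMap_hasDerivAt_tangent {N : ℕ} {Γ α c C B A₀ : ℝ} {γ : Fin N → ℝ}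
    {X Y : Fin N → ℝ → EuclideanSpace ℝ (Fin 3)} {Aa : Fin N → ℝ → ℝ}
    {u : (Fin N → ℝ → EuclideanSpace ℝ (Fin 3)) → EuclideanSpace ℝ (Fin 3) → EuclideanSpace ℝ (Fin 3)}
    {T : (Fin N → ℝ → EuclideanSpace ℝ (Fin 3)) → Fin N → ℝ → EuclideanSpace ℝ (Fin 3)}
    (hu : ∀ Z y, u Z y = ∑ k, (Γ * γ k / (4 * Real.pi)) • ∫ σ : ℝ,
      ((‖y - Z k σ‖ ^ 2 + Real.exp (-(1 + Real.eulerMascheroniConstant - Real.log 2)) * Aa k σ) ^ (3 / 2 : ℝ))⁻¹ •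
        cross (deriv (Z k) σ) (y - Z k σ))
    (hT : ∀ Z j τ, T Z j τ = (u Z (Z j τ) + (1 / 2 : ℝ) • Z j τ - α • cross (EuclideanSpace.single 2 1) (Z j τ))
      - (⟪u Z (Z j τ) + (1 / 2 : ℝ) • Z j τ - α • cross (EuclideanSpace.single 2 1) (Z j τ), deriv (Z j) τ⟫_ℝ
          / ‖deriv (Z j) τ‖ ^ 2) • deriv (Z j) τ)
    (hc : 0 < c) (hX : ∀ k, ContDiff ℝ 1 (X k)) (hX1 : ∀ k σ, ‖deriv (X k) σ‖ ≤ 1) (hXg : ∀ k σ, c * |σ| - C ≤ ‖X k σ‖)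
    (hA : ∀ k, Continuous (Aa k)) (hA₀ : 0 < A₀) (hA0 : ∀ k σ, A₀ ≤ Aa k σ)
    (hY : ∀ k, ContDiff ℝ 1 (Y k)) (hB : 0 ≤ B) (hYb : ∀ k σ, ‖Y k σ‖ ≤ B) (hY'b : ∀ k σ, ‖deriv (Y k) σ‖ ≤ B)
    (j : Fin N) (τ w : ℝ) (hunit : ‖deriv (X j) τ‖ = 1)
    (htan : u X (X j τ) + (1 / 2 : ℝ) • X j τ - α • cross (EuclideanSpace.single 2 1) (X j τ) = w • deriv (X j) τ) :
    HasDerivAt (fun s : ℝ => T (fun k σ => X k σ + s • Y k σ) j τ)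
      (((∑ k, (Γ * γ k / (4 * Real.pi)) • ∫ σ : ℝ,
          ((-3 * ⟪X j τ - X k σ, Y j τ - Y k σ⟫_ℝ *
              ((‖X j τ - X k σ‖ ^ 2 + Real.exp (-(1 + Real.eulerMascheroniConstant - Real.log 2)) * Aa k σ) ^ (5 / 2 : ℝ))⁻¹) •
            cross (deriv (X k) σ) (X j τ - X k σ) +
          ((‖X j τ - X k σ‖ ^ 2 + Real.exp (-(1 + Real.eulerMascheroniConstant - Real.log 2)) * Aa k σ) ^ (3 / 2 : ℝ))⁻¹ •
            (cross (deriv (X k) σ) (Y j τ - Y k σ) + cross (deriv (Y k) σ) (X j τ - X k σ))))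
        + (1 / 2 : ℝ) • Y j τ - α • cross (EuclideanSpace.single 2 1) (Y j τ))
       - ⟪((∑ k, (Γ * γ k / (4 * Real.pi)) • ∫ σ : ℝ,
          ((-3 * ⟪X j τ - X k σ, Y j τ - Y k σ⟫_ℝ *
              ((‖X j τ - X k σ‖ ^ 2 + Real.exp (-(1 + Real.eulerMascheroniConstant - Real.log 2)) * Aa k σ) ^ (5 / 2 : ℝ))⁻¹) •
            cross (deriv (X k) σ) (X j τ - X k σ) +
          ((‖X j τ - X k σ‖ ^ 2 + Real.exp (-(1 + Real.eulerMascheroniConstant - Real.log 2)) * Aa k σ) ^ (3 / 2 : ℝ))⁻¹ •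
            (cross (deriv (X k) σ) (Y j τ - Y k σ) + cross (deriv (Y k) σ) (X j τ - X k σ))))
        + (1 / 2 : ℝ) • Y j τ - α • cross (EuclideanSpace.single 2 1) (Y j τ)), deriv (X j) τ⟫_ℝ • deriv (X j) τ
       + (w * ⟪deriv (X j) τ, deriv (Y j) τ⟫_ℝ) • deriv (X j) τ - w • deriv (Y j) τ) 0 := by
  -- the velocity part and the tangent along the family
  have hW := velocityPart_hasDerivAt hu hc hX hX1 hXg hA hA₀ hA0 hY hB hYb hY'b j τ (α := α)
  have hP : HasDerivAt (fun s : ℝ => deriv (X j) τ + s • deriv (Y j) τ) (deriv (Y j) τ) 0 := by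
    simpa using ((hasDerivAt_id' (x := (0:ℝ))).smul_const (deriv (Y j) τ)).const_add (deriv (X j) τ)
  have hP1 : ‖(fun s : ℝ => deriv (X j) τ + s • deriv (Y j) τ) 0‖ = 1 := by simpa using hunit
  have hWs : (fun s : ℝ => u (fun k σ => X k σ + s • Y k σ) (X j τ + s • Y j τ) + (1 / 2 : ℝ) • (X j τ + s • Y j τ)
      - α • cross (EuclideanSpace.single 2 1) (X j τ + s • Y j τ)) 0
      = w • (fun s : ℝ => deriv (X j) τ + s • deriv (Y j) τ) 0 := by
    simpa using htan
  have key := hasDerivAt_tangencyDefect_unit hW hP hP1 hWs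
  -- rewrite the crux's `T` along the family
  have hfun : (fun s : ℝ => T (fun k σ => X k σ + s • Y k σ) j τ) = fun s : ℝ =>
      (u (fun k σ => X k σ + s • Y k σ) (X j τ + s • Y j τ) + (1 / 2 : ℝ) • (X j τ + s • Y j τ)
        - α • cross (EuclideanSpace.single 2 1) (X j τ + s • Y j τ))
      - (⟪u (fun k σ => X k σ + s • Y k σ) (X j τ + s • Y j τ) + (1 / 2 : ℝ) • (X j τ + s • Y j τ)
          - α • cross (EuclideanSpace.single 2 1) (X j τ + s • Y j τ), deriv (X j) τ + s • deriv (Y j) τ⟫_ℝ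
          / ‖deriv (X j) τ + s • deriv (Y j) τ‖ ^ 2) • (deriv (X j) τ + s • deriv (Y j) τ) := by
    funext s
    rw [hT, deriv_add_smul_curve (hX j) (hY j) s τ]
  rw [hfun]
  refine key.congr_deriv ?_
  simp

/-- **COROLLARY (the `deriv` that clause 13-J measures)**: under the same hypotheses,
`deriv (fun s => T (X + sY) j τ) 0 = W′ − ⟪W′, X_j′τ⟫•X_j′τ + (w⟪X_j′τ, Y_j′τ⟫)•X_j′τ − w•Y_j′τ`. [folklore] -/
theorem deriv_linearisedMap_tangent {N : ℕ} {Γ α c C B A₀ : ℝ} {γ : Fin N → ℝ}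
    {X Y : Fin N → ℝ → EuclideanSpace ℝ (Fin 3)} {Aa : Fin N → ℝ → ℝ}
    {u : (Fin N → ℝ → EuclideanSpace ℝ (Fin 3)) → EuclideanSpace ℝ (Fin 3) → EuclideanSpace ℝ (Fin 3)}
    {T : (Fin N → ℝ → EuclideanSpace ℝ (Fin 3)) → Fin N → ℝ → EuclideanSpace ℝ (Fin 3)}
    (hu : ∀ Z y, u Z y = ∑ k, (Γ * γ k / (4 * Real.pi)) • ∫ σ : ℝ,
      ((‖y - Z k σ‖ ^ 2 + Real.exp (-(1 + Real.eulerMascheroniConstant - Real.log 2)) * Aa k σ) ^ (3 / 2 : ℝ))⁻¹ •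
        cross (deriv (Z k) σ) (y - Z k σ))
    (hT : ∀ Z j τ, T Z j τ = (u Z (Z j τ) + (1 / 2 : ℝ) • Z j τ - α • cross (EuclideanSpace.single 2 1) (Z j τ))
      - (⟪u Z (Z j τ) + (1 / 2 : ℝ) • Z j τ - α • cross (EuclideanSpace.single 2 1) (Z j τ), deriv (Z j) τ⟫_ℝ
          / ‖deriv (Z j) τ‖ ^ 2) • deriv (Z j) τ)
    (hc : 0 < c) (hX : ∀ k, ContDiff ℝ 1 (X k)) (hX1 : ∀ k σ, ‖deriv (X k) σ‖ ≤ 1) (hXg : ∀ k σ, c * |σ| - C ≤ ‖X k σ‖)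
    (hA : ∀ k, Continuous (Aa k)) (hA₀ : 0 < A₀) (hA0 : ∀ k σ, A₀ ≤ Aa k σ)
    (hY : ∀ k, ContDiff ℝ 1 (Y k)) (hB : 0 ≤ B) (hYb : ∀ k σ, ‖Y k σ‖ ≤ B) (hY'b : ∀ k σ, ‖deriv (Y k) σ‖ ≤ B)
    (j : Fin N) (τ w : ℝ) (hunit : ‖deriv (X j) τ‖ = 1)
    (htan : u X (X j τ) + (1 / 2 : ℝ) • X j τ - α • cross (EuclideanSpace.single 2 1) (X j τ) = w • deriv (X j) τ) :
    deriv (fun s : ℝ => T (fun k σ => X k σ + s • Y k σ) j τ) 0 =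
      ((∑ k, (Γ * γ k / (4 * Real.pi)) • ∫ σ : ℝ,
          ((-3 * ⟪X j τ - X k σ, Y j τ - Y k σ⟫_ℝ *
              ((‖X j τ - X k σ‖ ^ 2 + Real.exp (-(1 + Real.eulerMascheroniConstant - Real.log 2)) * Aa k σ) ^ (5 / 2 : ℝ))⁻¹) •
            cross (deriv (X k) σ) (X j τ - X k σ) +
          ((‖X j τ - X k σ‖ ^ 2 + Real.exp (-(1 + Real.eulerMascheroniConstant - Real.log 2)) * Aa k σ) ^ (3 / 2 : ℝ))⁻¹ •
            (cross (deriv (X k) σ) (Y j τ - Y k σ) + cross (deriv (Y k) σ) (X j τ - X k σ))))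
        + (1 / 2 : ℝ) • Y j τ - α • cross (EuclideanSpace.single 2 1) (Y j τ))
       - ⟪((∑ k, (Γ * γ k / (4 * Real.pi)) • ∫ σ : ℝ,
          ((-3 * ⟪X j τ - X k σ, Y j τ - Y k σ⟫_ℝ *
              ((‖X j τ - X k σ‖ ^ 2 + Real.exp (-(1 + Real.eulerMascheroniConstant - Real.log 2)) * Aa k σ) ^ (5 / 2 : ℝ))⁻¹) •
            cross (deriv (X k) σ) (X j τ - X k σ) +
          ((‖X j τ - X k σ‖ ^ 2 + Real.exp (-(1 + Real.eulerMascheroniConstant - Real.log 2)) * Aa k σ) ^ (3 / 2 : ℝ))⁻¹ •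
            (cross (deriv (X k) σ) (Y j τ - Y k σ) + cross (deriv (Y k) σ) (X j τ - X k σ))))
        + (1 / 2 : ℝ) • Y j τ - α • cross (EuclideanSpace.single 2 1) (Y j τ)), deriv (X j) τ⟫_ℝ • deriv (X j) τ
       + (w * ⟪deriv (X j) τ, deriv (Y j) τ⟫_ℝ) • deriv (X j) τ - w • deriv (Y j) τ :=
  (linearisedMap_hasDerivAt_tangent hu hT hc hX hX1 hXg hA hA₀ hA0 hY hB hYb hY'b j τ w hunit htan).deriv

end Summit.NavierStokesRegularity.NavierStokesRegularity.Theorems.MatchedKernel
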